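import Summits.Langlands.Langlands.Theorems.MinimalLevelDescentLevelPrimeDescentOfResplit
import Summits.Langlands.Langlands.Theorems.LevelOneDyadicKernel
import Summits.Langlands.Langlands.Theorems.LevelOneDyadicResidue
import Literature.NumberTheory.GaloisRepresentations.LabelledWeightsDeRhamRank
import Literature.NumberTheory.GaloisRepresentations.StableLatticeValuationRing
import Literature.RepresentationTheory.Semisimple.Semisimplification
import Literature.Barriers.Langlands.TaylorWilesNumericalCoincidence
import Summits.Langlands.Langlands.Theses.ZeroDefectWeightNormalForm

/-!
# Level-one dyadic descent — the WEIGHT coordinate (lens-4 g22 kernels, census twin of node `ZeroDefectWeightNormalForm`)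

Z = `MinimalLevelDescent.LevelOneCrystallineDescent` (stmt-Langlands-31277) is cut on the SIZE of the Hodge–Tate weights, guarded by the
Taylor–Wiles numerical defect: dial `IsZeroDefect K n := n ≤ 1 ∨ (n = 2 ∧ K totally real)` (= `defectGL r₁ r₂ n = 0`,
`isZeroDefect_iff_defectGL`), `HasSpreadLE ρ c`, `SharesResidual ρ ρ'`; pieces RED `BoundedWeightRepresentative` (zero defect: a congruent
level-one crystalline representative of spread ≤ n·ℓ² exists), ZB `BoundedWeightLevelOneDescent` (Z restricted to zero defect ∧ spread ≤ n·ℓ²),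
ZP `PositiveDefectLevelOneDescent` (Z restricted to positive defect).  Kernels (0 sorry): `z_of_pieces : RED → ZB → ZP → Z`,
`z_iff_pieces : RED → (Z ↔ ZB ∧ ZP)`, `minimal_counterexample`, `bounded_of_z`, `positiveDefect_of_z`, `*_of_langlands`,
`exists_isResidualRepOf` (any rank: integral model over ℤ̄_ℓ + semisimplification), `hasSpreadLE_of_rank_one`, `representativeAt_rank_one`
(RED's rank-one cell), `representativeAt_iff_rankTwo` (RED ⟺ its GL₂/totally-real cell), `positiveDefectBelow_three_le`, `z_of_cells`, `root_of_cells`.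
CENSUS TWIN (census-1 g25, landing of the lens's M1 file): the route is BORN (76th cell route, route-Langlands-ZeroDefectWeightNormalForm rev 3
@409568c620ea; items ZP stmt-Langlands-27704 · ZB 27705 · RED 27706 · Assembly 27707 CLOSED by `Theorems/ZeroDefectWeightNormalFormAssembly.lean`), so
RED / ZB / ZP / Assembly are NOT re-declared here: every kernel refers to the BORN ROUTE DECLS BY NAME
(`open Summit.Langlands.Langlands.Theses.ZeroDefectWeightNormalForm (…)`); RED's BC5 rung `representativeAt_rank_one` becomes a tree theorem
(`--supports stmt-Langlands-31277 --as helper`).  Nothing here proves `Langlands` or Z.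
Sources: Khare–Wintenberger, Annals 169 (2009) Thm 6.1; Buzzard–Diamond–Jarvis, Duke 155 (2010) §3; Emerton–Gee, AMS 215 (2023) Thm 6.4.4;
Barnet-Lamb–Gee–Geraghty–Taylor, Annals 179 (2014) Thm 4.3.1; Calegari–Geraghty, Invent. 211 (2018) §1.
-/

set_option linter.dupNamespace false

namespace Summit.Langlands.Langlands.Theorems.LevelOneDyadic.Weight

open Summit.Langlands.Langlands.Theses.ZeroDefectWeightNormalForm (BoundedWeightRepresentative BoundedWeightLevelOneDescent
  PositiveDefectLevelOneDescent Assembly)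

open scoped NumberField
open Filter IsDedekindDomain
open Literature.NumberTheory.GaloisRepresentations Literature.NumberTheory.Automorphic
open Summit.Langlands.Langlands.Theses
open Summit.Langlands.Langlands.Theorems.LevelOneDyadic
open Summit.Langlands.Langlands.Theorems.LevelOneDyadic.Residue

variable {K : Type} [Field K] [NumberField K] {ℓ : ℕ} [Fact ℓ.Prime] {n : ℕ}

/-! ## Vocabulary I — the dial: numerical defect, Hodge–Tate spread, shared residual representation -/

/-- ZERO NUMERICAL DEFECT of `Res_{K/ℚ} GL_n`: `n ≤ 1`, or `n = 2` and `K` totally real — the vanishing locus of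
`l₀ = r₁⌊(n−1)/2⌋ + r₂(n−1)` (`isZeroDefect_iff_defectGL`). [dial] -/
def IsZeroDefect (K : Type) [Field K] [NumberField K] (n : ℕ) : Prop := n ≤ 1 ∨ (n = 2 ∧ NumberField.IsTotallyReal K)

/-- BRIDGE TO THE CATALOGUED BARRIER: the dial is exactly `defectGL r₁(K) r₂(K) n = 0`
(`Literature.Barriers.Langlands.defectGL_eq_zero_iff`, Calegari–Geraghty §1 / Khare–Thorne). -/
theorem isZeroDefect_iff_defectGL (K : Type) [Field K] [NumberField K] (n : ℕ) :
    IsZeroDefect K n ↔ Literature.Barriers.Langlands.defectGL (NumberField.InfinitePlace.nrRealPlaces K)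
      (NumberField.InfinitePlace.nrComplexPlaces K) n = 0 := by
  have hpos : 0 < NumberField.InfinitePlace.nrRealPlaces K + NumberField.InfinitePlace.nrComplexPlaces K := by
    rw [← NumberField.InfinitePlace.card_eq_nrRealPlaces_add_nrComplexPlaces]
    exact Fintype.card_pos
  rw [Literature.Barriers.Langlands.defectGL_eq_zero_iff hpos, IsZeroDefect, NumberField.nrComplexPlaces_eq_zero_iff]

/-- Positive rank and zero defect means rank one, or rank two over a totally real field. -/
theorem isZeroDefect_iff_of_pos (K : Type) [Field K] [NumberField K] {n : ℕ} (hn : 0 < n) :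
    IsZeroDefect K n ↔ n = 1 ∨ (n = 2 ∧ NumberField.IsTotallyReal K) := by
  unfold IsZeroDefect
  constructor
  · rintro (h | h)
    · exact Or.inl (by omega)
    · exact Or.inr h
  · rintro (h | h)
    · exact Or.inl (by omega)
    · exact Or.inr h

/-- Rank ≥ 3 has positive defect over every number field. -/
theorem not_isZeroDefect_of_three_le (K : Type) [Field K] [NumberField K] {n : ℕ} (hn : 3 ≤ n) : ¬ IsZeroDefect K n := by
  rintro (h | ⟨h, _⟩) <;> omega

/-- The Hodge–Tate multiset of `ρ` at `v ∣ ℓ` for the continuous label `e : K_v → ℚ̄_ℓ` (Fontaine's pinned datum). [abbreviation] -/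
noncomputable def htAt (ρ : FramedGaloisRep K (PadicAlgCl ℓ) n) (v : HeightOneSpectrum (𝓞 K)) (hv : ((ℓ : ℕ) : 𝓞 K) ∈ v.asIdeal)
    (e : v.adicCompletion K →+* PadicAlgCl ℓ) : Multiset ℤ :=
  ρ.labelledHodgeTateWeightsAt v (Literature.NumberTheory.PAdicHodge.fontainePstAdicCompletion v ℓ hv).algebra
    (Literature.NumberTheory.PAdicHodge.fontainePstAdicCompletion v ℓ hv).𝔅 e

/-- SPREAD ≤ c: at every `v ∣ ℓ` and every continuous label, any two labelled Hodge–Tate weights of `ρ` differ by at most `c`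
(twist-invariant; for GL₂ of classical weight (k_τ) the spread at label τ is k_τ − 1). [dial] -/
def HasSpreadLE (ρ : FramedGaloisRep K (PadicAlgCl ℓ) n) (c : ℕ) : Prop :=
  ∀ (v : HeightOneSpectrum (𝓞 K)) (hv : ((ℓ : ℕ) : 𝓞 K) ∈ v.asIdeal) (e : v.adicCompletion K →+* PadicAlgCl ℓ), Continuous e →
    ∀ a ∈ ρ.labelledHodgeTateWeightsAt v (Literature.NumberTheory.PAdicHodge.fontainePstAdicCompletion v ℓ hv).algebra
        (Literature.NumberTheory.PAdicHodge.fontainePstAdicCompletion v ℓ hv).𝔅 e,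
      ∀ b ∈ ρ.labelledHodgeTateWeightsAt v (Literature.NumberTheory.PAdicHodge.fontainePstAdicCompletion v ℓ hv).algebra
        (Literature.NumberTheory.PAdicHodge.fontainePstAdicCompletion v ℓ hv).𝔅 e, a - b ≤ (c : ℤ)

/-- Unfolding lemma for `HasSpreadLE`: the labelled Hodge–Tate weights of `ρ` at every place above `ℓ` lie in a window of length `c`. [folklore] -/
theorem hasSpreadLE_iff (ρ : FramedGaloisRep K (PadicAlgCl ℓ) n) (c : ℕ) :
    HasSpreadLE ρ c ↔ ∀ (v : HeightOneSpectrum (𝓞 K)) (hv : ((ℓ : ℕ) : 𝓞 K) ∈ v.asIdeal)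
      (e : v.adicCompletion K →+* PadicAlgCl ℓ), Continuous e → ∀ a ∈ htAt ρ v hv e, ∀ b ∈ htAt ρ v hv e, a - b ≤ (c : ℤ) :=
  Iff.rfl

/-- Spread bounds are monotone in the constant. -/
theorem HasSpreadLE.mono {ρ : FramedGaloisRep K (PadicAlgCl ℓ) n} {c c' : ℕ} (h : HasSpreadLE ρ c) (hcc' : c ≤ c') :
    HasSpreadLE ρ c' := fun v hv e he a ha b hb =>
  (h v hv e he a ha b hb).trans (by exact_mod_cast hcc')

/-- A multiset with at most one element has spread 0: in RANK ONE every pinned-geometric ρ has spread ≤ c for every c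
(`card HT_e(ρ|_{K_v}) = n` at a de Rham place, `FramedGaloisRep.card_labelledHodgeTateWeightsAt_eq_of_isDeRhamFramed`). -/
theorem hasSpreadLE_of_rank_one (ρ : FramedGaloisRep K (PadicAlgCl ℓ) 1) (hgeo : IsPinnedGeometric ρ) (c : ℕ) :
    HasSpreadLE ρ c := by
  intro v hv e he a ha b hb
  have hcard := FramedGaloisRep.card_labelledHodgeTateWeightsAt_eq_of_isDeRhamFramed ρ v hv (hgeo.2 v hv) e he
  obtain ⟨x, hx⟩ := Multiset.card_eq_one.mp hcard
  rw [hx, Multiset.mem_singleton] at ha hb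
  subst ha; subst hb
  simp

/-- `ρ` and `ρ'` SHARE A RESIDUAL REPRESENTATION τ : Γ_K → GL_n(ℤ̄_ℓ/𝔪): τ is a (semisimplified) reduction of both. [dial] -/
def SharesResidual (ρ ρ' : FramedGaloisRep K (PadicAlgCl ℓ) n) : Prop :=
  ∃ τ : Field.absoluteGaloisGroup K →* GL (Fin n) (padicAlgClResidueField ℓ),
    ρ.IsResidualRepOf (RingHom.id _) τ ∧ ρ'.IsResidualRepOf (RingHom.id _) τ

/-- **Every `ρ : Γ_K → GL_n(ℚ̄_ℓ)` has a residual representation** (any rank): an integral model over the open valuation ring ℤ̄_ℓ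
exists (`exists_integralModel_of_valuationSubring`) and its reduction has a semisimplification (Deligne–Serre,
`Literature.RepresentationTheory.Semisimple.exists_semisimplification`).  The rank-two case is
`FramedGaloisRep.exists_isResidualRepOf_fin_two`. [folklore] -/
theorem exists_isResidualRepOf (ρ : FramedGaloisRep K (PadicAlgCl ℓ) n) :
    ∃ τ : Field.absoluteGaloisGroup K →* GL (Fin n) (padicAlgClResidueField ℓ), ρ.IsResidualRepOf (RingHom.id _) τ := by
  have hOopen : IsOpen ((padicAlgClIntegers ℓ : ValuationSubring (PadicAlgCl ℓ)) : Set (PadicAlgCl ℓ)) :=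
    Valued.isOpen_valuationSubring _
  obtain ⟨P, ρ₀, hρ₀⟩ := exists_integralModel_of_valuationSubring (O := padicAlgClIntegers ℓ) hOopen ρ
  obtain ⟨τ, hss, hcp, hker⟩ :=
    Literature.RepresentationTheory.Semisimple.exists_semisimplification (integralReduction (RingHom.id _) ρ₀)
  exact ⟨τ, integralReduction (RingHom.id _) ρ₀, ⟨ρ₀, 1, ⟨P, hρ₀⟩, fun g => by simp⟩, hss, hcp, hker⟩

/-- `SharesResidual` is reflexive (a representation shares its semisimplified residual representation with itself). [folklore] -/
theorem sharesResidual_refl (ρ : FramedGaloisRep K (PadicAlgCl ℓ) n) : SharesResidual ρ ρ := by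
  obtain ⟨τ, h⟩ := exists_isResidualRepOf ρ
  exact ⟨τ, h, h⟩

omit [NumberField K] in
/-- `SharesResidual` is symmetric. [folklore] -/
theorem SharesResidual.symm {ρ ρ' : FramedGaloisRep K (PadicAlgCl ℓ) n} (h : SharesResidual ρ ρ') : SharesResidual ρ' ρ := by
  obtain ⟨τ, h₁, h₂⟩ := h
  exact ⟨τ, h₂, h₁⟩

/-- KERNEL III read through the dial: residual automorphy passes between representations sharing a residual representation. -/
theorem isResiduallyAutomorphic_of_sharesResidual {hcpt : isCompact_glFiniteIntegralLevel n K} {ι : PadicAlgCl ℓ ≃+* ℂ}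
    {ρ ρ' : FramedGaloisRep K (PadicAlgCl ℓ) n} (h : SharesResidual ρ ρ')
    (hur : ∀ᶠ v : HeightOneSpectrum (𝓞 K) in cofinite, ρ.IsUnramifiedAt v) (h' : IsResiduallyAutomorphic hcpt ι ρ') :
    IsResiduallyAutomorphic hcpt ι ρ := by
  obtain ⟨τ, hτ, hτ'⟩ := h
  exact isResiduallyAutomorphic_of_sharedResidual hτ hτ' hur h'

/-! ## Vocabulary II — Z's instance set at the prime ℓ under the two guards, and RED at ℓ -/

/-- ZB below ℓ: Z's level-one crystalline instances at ℓ of ZERO DEFECT and SPREAD ≤ n·ℓ² are residually automorphic. -/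
def BoundedBelow (ℓ : ℕ) [Fact ℓ.Prime] : Prop :=
  ∀ (K : Type) [Field K] [NumberField K] (n : ℕ) (hcpt : isCompact_glFiniteIntegralLevel n K), 0 < n →
    ∀ (ι : PadicAlgCl ℓ ≃+* ℂ) (ρ : FramedGaloisRep K (PadicAlgCl ℓ) n), ρ.toGaloisRep.IsIrreducible →
      IsPinnedGeometric ρ → IsCrystallineAbove ρ → IsUnramifiedAwayFrom ρ → IsZeroDefect K n → HasSpreadLE ρ (n * ℓ ^ 2) →
        IsResiduallyAutomorphic hcpt ι ρ

/-- ZP below ℓ: Z's level-one crystalline instances at ℓ of POSITIVE DEFECT are residually automorphic. -/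
def PositiveDefectBelow (ℓ : ℕ) [Fact ℓ.Prime] : Prop :=
  ∀ (K : Type) [Field K] [NumberField K] (n : ℕ) (hcpt : isCompact_glFiniteIntegralLevel n K), 0 < n →
    ∀ (ι : PadicAlgCl ℓ ≃+* ℂ) (ρ : FramedGaloisRep K (PadicAlgCl ℓ) n), ρ.toGaloisRep.IsIrreducible →
      IsPinnedGeometric ρ → IsCrystallineAbove ρ → IsUnramifiedAwayFrom ρ → ¬ IsZeroDefect K n →
        IsResiduallyAutomorphic hcpt ι ρ

/-- RED at ℓ: on the zero-defect locus every irreducible pinned-geometric crystalline level-one ρ has a representative ρ′ of the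
same kind with spread ≤ n·ℓ² and a shared residual representation. -/
def RepresentativeAt (ℓ : ℕ) [Fact ℓ.Prime] : Prop :=
  ∀ (K : Type) [Field K] [NumberField K] (n : ℕ), 0 < n → IsZeroDefect K n →
    ∀ (ρ : FramedGaloisRep K (PadicAlgCl ℓ) n), ρ.toGaloisRep.IsIrreducible →
      IsPinnedGeometric ρ → IsCrystallineAbove ρ → IsUnramifiedAwayFrom ρ →
        ∃ ρ' : FramedGaloisRep K (PadicAlgCl ℓ) n, ρ'.toGaloisRep.IsIrreducible ∧ IsPinnedGeometric ρ' ∧ IsCrystallineAbove ρ' ∧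
          IsUnramifiedAwayFrom ρ' ∧ HasSpreadLE ρ' (n * ℓ ^ 2) ∧ SharesResidual ρ ρ'

/-- RED's genuinely open cell: RANK TWO over TOTALLY REAL fields (spread ≤ 2ℓ²). -/
def RankTwoRepresentativeAt (ℓ : ℕ) [Fact ℓ.Prime] : Prop :=
  ∀ (K : Type) [Field K] [NumberField K], NumberField.IsTotallyReal K →
    ∀ (ρ : FramedGaloisRep K (PadicAlgCl ℓ) 2), ρ.toGaloisRep.IsIrreducible →
      IsPinnedGeometric ρ → IsCrystallineAbove ρ → IsUnramifiedAwayFrom ρ →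
        ∃ ρ' : FramedGaloisRep K (PadicAlgCl ℓ) 2, ρ'.toGaloisRep.IsIrreducible ∧ IsPinnedGeometric ρ' ∧ IsCrystallineAbove ρ' ∧
          IsUnramifiedAwayFrom ρ' ∧ HasSpreadLE ρ' (2 * ℓ ^ 2) ∧ SharesResidual ρ ρ'

/-! ## The pieces (filed texts: RED self-contained; ZB / ZP = Z's text verbatim with ONE inserted guard each) -/





/-! ## Bridges — every filed text is the vocabulary form, definitionally (`Iff.rfl`) -/

/-- RED, by name, unfolds to its per-prime form `∀ ℓ ≠ 2, RepresentativeAt ℓ` (text identity with the born route decl). [folklore] -/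
theorem boundedWeightRepresentative_iff :
    BoundedWeightRepresentative ↔ ∀ (ℓ : ℕ) [Fact ℓ.Prime], ℓ ≠ 2 → RepresentativeAt ℓ :=
  Iff.rfl

/-- ZB, by name, unfolds to its per-prime form (text identity with the born route decl). [folklore] -/
theorem boundedWeightLevelOneDescent_iff :
    BoundedWeightLevelOneDescent ↔ (WPlus → LiftW → ∀ (ℓ : ℕ) [Fact ℓ.Prime], ℓ ≠ 2 → LevelOneIH ℓ → BoundedBelow ℓ) :=
  Iff.rfl

/-- ZP, by name, unfolds to its per-prime form (text identity with the born route decl). [folklore] -/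
theorem positiveDefectLevelOneDescent_iff :
    PositiveDefectLevelOneDescent ↔ (WPlus → LiftW → ∀ (ℓ : ℕ) [Fact ℓ.Prime], ℓ ≠ 2 → LevelOneIH ℓ → PositiveDefectBelow ℓ) :=
  Iff.rfl

/-- Z (the tree item stmt-Langlands-31277) read in the vocabulary (landed `levelOneCrystallineDescent_iff` ∘ `_iff_item_31277`). -/
theorem z_iff : MinimalLevelDescent.LevelOneCrystallineDescent ↔
    (WPlus → LiftW → ∀ (ℓ : ℕ) [Fact ℓ.Prime], ℓ ≠ 2 → LevelOneIH ℓ → LevelOneBelow ℓ) :=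
  levelOneCrystallineDescent_iff_item_31277.symm.trans levelOneCrystallineDescent_iff

/-! ## KERNEL I — NECESSITY: Z ⟹ ZB and Z ⟹ ZP (drop the inserted guard); the member-level dichotomy is excluded middle -/

/-- Necessity: level-one descent below `ℓ` implies its zero-defect bounded-weight restriction ZB below `ℓ`. [folklore] -/
theorem boundedBelow_of_levelOneBelow (h : LevelOneBelow ℓ) : BoundedBelow ℓ :=
  fun K _ _ n hcpt hn ι ρ hirr hgeo hcry hlev _ _ => h K n hcpt hn ι ρ hirr hgeo hcry hlev

/-- Necessity: level-one descent below `ℓ` implies its positive-defect restriction ZP below `ℓ`. [folklore] -/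
theorem positiveDefectBelow_of_levelOneBelow (h : LevelOneBelow ℓ) : PositiveDefectBelow ℓ :=
  fun K _ _ n hcpt hn ι ρ hirr hgeo hcry hlev _ => h K n hcpt hn ι ρ hirr hgeo hcry hlev

/-- Z ⟹ ZB. -/
theorem bounded_of_z (hZ : MinimalLevelDescent.LevelOneCrystallineDescent) : BoundedWeightLevelOneDescent := by
  rw [boundedWeightLevelOneDescent_iff]
  rw [z_iff] at hZ
  intro hW hL ℓ _ hℓ2 hIH
  exact boundedBelow_of_levelOneBelow (hZ hW hL ℓ hℓ2 hIH)

/-- Z ⟹ ZP. -/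
theorem positiveDefect_of_z (hZ : MinimalLevelDescent.LevelOneCrystallineDescent) : PositiveDefectLevelOneDescent := by
  rw [positiveDefectLevelOneDescent_iff]
  rw [z_iff] at hZ
  intro hW hL ℓ _ hℓ2 hIH
  exact positiveDefectBelow_of_levelOneBelow (hZ hW hL ℓ hℓ2 hIH)

/-- Excluded middle on the numerical-defect dial `IsZeroDefect K n`. [folklore] -/
theorem defect_dichotomy (K : Type) [Field K] [NumberField K] (n : ℕ) : IsZeroDefect K n ∨ ¬ IsZeroDefect K n := em _

/-! ## KERNEL II — SUFFICIENCY: RED ∧ ZB ∧ ZP ⟹ Z (case split on the defect; congruence transfer through KERNEL III) -/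

/-- At one prime: RED(ℓ) ∧ ZB(ℓ) ∧ ZP(ℓ) ⟹ Z's instance set at ℓ. -/
theorem levelOneBelow_of_pieces (hRED : RepresentativeAt ℓ) (hZB : BoundedBelow ℓ) (hZP : PositiveDefectBelow ℓ) :
    LevelOneBelow ℓ := by
  intro K _ _ n hcpt hn ι ρ hirr hgeo hcry hlev
  by_cases hD : IsZeroDefect K n
  · obtain ⟨ρ', hirr', hgeo', hcry', hlev', hbd, hsh⟩ := hRED K n hn hD ρ hirr hgeo hcry hlev
    exact isResiduallyAutomorphic_of_sharesResidual hsh hgeo.1 (hZB K n hcpt hn ι ρ' hirr' hgeo' hcry' hlev' hD hbd)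
  · exact hZP K n hcpt hn ι ρ hirr hgeo hcry hlev hD

/-- ZB(ℓ) ∧ ZP(ℓ) ⟸ Z's instance set at ℓ, exactly. -/
theorem levelOneBelow_iff_pieces (hRED : RepresentativeAt ℓ) :
    LevelOneBelow ℓ ↔ BoundedBelow ℓ ∧ PositiveDefectBelow ℓ :=
  ⟨fun h => ⟨boundedBelow_of_levelOneBelow h, positiveDefectBelow_of_levelOneBelow h⟩,
    fun h => levelOneBelow_of_pieces hRED h.1 h.2⟩

/-- RED → ZB → ZP → Z. -/
theorem z_of_pieces (hRED : BoundedWeightRepresentative) (hZB : BoundedWeightLevelOneDescent)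
    (hZP : PositiveDefectLevelOneDescent) : MinimalLevelDescent.LevelOneCrystallineDescent := by
  rw [z_iff]
  rw [boundedWeightRepresentative_iff] at hRED
  rw [boundedWeightLevelOneDescent_iff] at hZB
  rw [positiveDefectLevelOneDescent_iff] at hZP
  intro hW hL ℓ _ hℓ2 hIH
  exact levelOneBelow_of_pieces (hRED ℓ hℓ2) (hZB hW hL ℓ hℓ2 hIH) (hZP hW hL ℓ hℓ2 hIH)

/-- Given RED, the cut is EXACT: Z ⟺ ZB ∧ ZP. -/
theorem z_iff_pieces (hRED : BoundedWeightRepresentative) :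
    MinimalLevelDescent.LevelOneCrystallineDescent ↔ BoundedWeightLevelOneDescent ∧ PositiveDefectLevelOneDescent :=
  ⟨fun h => ⟨bounded_of_z h, positiveDefect_of_z h⟩, fun h => z_of_pieces hRED h.1 h.2⟩


/-! ## KERNEL III — NECESSITY FROM LANGLANDS: ZB and ZP are S-implied (through the landed `levelOneCrystallineDescent_of_langlands`) -/

/-- Z (`MinimalLevelDescent.LevelOneCrystallineDescent`) follows from the summit statement `Langlands` (through the host route's landed kernels). [folklore] -/
theorem z_of_langlands (hLg : _root_.Langlands) : MinimalLevelDescent.LevelOneCrystallineDescent :=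
  levelOneCrystallineDescent_iff_item_31277.mp (levelOneCrystallineDescent_of_langlands hLg)

/-- ZB follows from the summit statement `Langlands`. [folklore] -/
theorem bounded_of_langlands (hLg : _root_.Langlands) : BoundedWeightLevelOneDescent := bounded_of_z (z_of_langlands hLg)

/-- ZP follows from the summit statement `Langlands`. [folklore] -/
theorem positiveDefect_of_langlands (hLg : _root_.Langlands) : PositiveDefectLevelOneDescent :=
  positiveDefect_of_z (z_of_langlands hLg)

/-! ## KERNEL IV — PROVED CELLS OF RED: the identity rung and the whole rank-one cell; RED ⟺ its rank-two totally-real cell -/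

/-- (R1) IDENTITY RUNG: an instance whose own spread is ≤ n·ℓ² is its own representative (residual representations exist). -/
theorem representative_of_hasSpreadLE {ρ : FramedGaloisRep K (PadicAlgCl ℓ) n} (hirr : ρ.toGaloisRep.IsIrreducible)
    (hgeo : IsPinnedGeometric ρ) (hcry : IsCrystallineAbove ρ) (hlev : IsUnramifiedAwayFrom ρ) (hbd : HasSpreadLE ρ (n * ℓ ^ 2)) :
    ∃ ρ' : FramedGaloisRep K (PadicAlgCl ℓ) n, ρ'.toGaloisRep.IsIrreducible ∧ IsPinnedGeometric ρ' ∧ IsCrystallineAbove ρ' ∧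
      IsUnramifiedAwayFrom ρ' ∧ HasSpreadLE ρ' (n * ℓ ^ 2) ∧ SharesResidual ρ ρ' :=
  ⟨ρ, hirr, hgeo, hcry, hlev, hbd, sharesResidual_refl ρ⟩

/-- (R2) THE RANK-ONE CELL OF RED HOLDS OUTRIGHT (characters have spread 0). -/
theorem representativeAt_rank_one (K : Type) [Field K] [NumberField K] (ρ : FramedGaloisRep K (PadicAlgCl ℓ) 1)
    (hirr : ρ.toGaloisRep.IsIrreducible) (hgeo : IsPinnedGeometric ρ) (hcry : IsCrystallineAbove ρ) (hlev : IsUnramifiedAwayFrom ρ) :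
    ∃ ρ' : FramedGaloisRep K (PadicAlgCl ℓ) 1, ρ'.toGaloisRep.IsIrreducible ∧ IsPinnedGeometric ρ' ∧ IsCrystallineAbove ρ' ∧
      IsUnramifiedAwayFrom ρ' ∧ HasSpreadLE ρ' (1 * ℓ ^ 2) ∧ SharesResidual ρ ρ' :=
  representative_of_hasSpreadLE hirr hgeo hcry hlev (hasSpreadLE_of_rank_one ρ hgeo _)

/-- RED(ℓ) ⟺ its RANK-TWO TOTALLY-REAL cell: the rank-one cell is proved (R2), and zero defect in positive rank is n = 1 or
(n = 2, K totally real). -/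
theorem representativeAt_iff_rankTwo : RepresentativeAt ℓ ↔ RankTwoRepresentativeAt ℓ := by
  constructor
  · intro h K _ _ hK ρ hirr hgeo hcry hlev
    exact h K 2 two_pos (Or.inr ⟨rfl, hK⟩) ρ hirr hgeo hcry hlev
  · intro h K _ _ n hn hD ρ hirr hgeo hcry hlev
    rcases (isZeroDefect_iff_of_pos K hn).mp hD with h1 | ⟨h2, hK⟩
    · subst h1
      exact representativeAt_rank_one K ρ hirr hgeo hcry hlev
    · subst h2
      exact h K hK ρ hirr hgeo hcry hlev

/-- Hence RED ⟺ «for every odd ℓ, the rank-two totally-real cell». -/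
theorem boundedWeightRepresentative_iff_rankTwo :
    BoundedWeightRepresentative ↔ ∀ (ℓ : ℕ) [Fact ℓ.Prime], ℓ ≠ 2 → RankTwoRepresentativeAt ℓ := by
  rw [boundedWeightRepresentative_iff]
  exact forall_congr' fun ℓ => forall_congr' fun _ => forall_congr' fun _ => representativeAt_iff_rankTwo

/-- (R3) POSITIVE-DEFECT READING OF ZP: in rank ≥ 3 the guard is automatic — ZP contains Z's whole rank-≥-3 slice. -/
theorem positiveDefectBelow_three_le (h : PositiveDefectBelow ℓ) (K : Type) [Field K] [NumberField K] (n : ℕ) (hn : 3 ≤ n)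
    (hcpt : isCompact_glFiniteIntegralLevel n K) (ι : PadicAlgCl ℓ ≃+* ℂ) (ρ : FramedGaloisRep K (PadicAlgCl ℓ) n)
    (hirr : ρ.toGaloisRep.IsIrreducible) (hgeo : IsPinnedGeometric ρ) (hcry : IsCrystallineAbove ρ) (hlev : IsUnramifiedAwayFrom ρ) :
    IsResiduallyAutomorphic hcpt ι ρ :=
  h K n hcpt (by omega) ι ρ hirr hgeo hcry hlev (not_isZeroDefect_of_three_le K hn)

/-! ## KERNEL V — the deciding theorems -/

/-- DECIDING THEOREM of the child route (V-R, `--refines route-Langlands-MinimalLevelDescent:LevelOneCrystallineDescent`):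
three load-bearing binders RED → ZB → ZP → Z, concluding the host item BY NAME (case split on the defect + KERNEL III). -/
theorem z_of_cells (hRED : BoundedWeightRepresentative) (hZB : BoundedWeightLevelOneDescent) (hZP : PositiveDefectLevelOneDescent) :
    MinimalLevelDescent.LevelOneCrystallineDescent :=
  z_of_pieces hRED hZB hZP

/-- Root form: the three pieces in place of Z among the host route's resplit binders (K, W_move, L_move ⟹ D by the landed
`Theorems.LevelPrimeDescent_of_resplit_proof`; then D, B₂, Lift, W⁺, P, A, R ⟹ Langlands by the host's `MinimalLevelDescent.closes`). -/
theorem root_of_cells (hRED : BoundedWeightRepresentative) (hZB : BoundedWeightLevelOneDescent) (hZP : PositiveDefectLevelOneDescent)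
    (hK : MinimalLevelDescent.ResidualInertiaDescent) (hWM : MinimalLevelDescent.WeightMove) (hLM : MinimalLevelDescent.LevelMove)
    (hB : MinimalLevelDescent.DyadicLevelOneAutomorphy) (hL : MinimalLevelDescent.AutomorphyLifting)
    (hW : MinimalLevelDescent.SatakeAvatarExistence) (hP : MinimalLevelDescent.PadicMemberCompatibility)
    (hA : MinimalLevelDescent.CompatibilityAwayFromLR) (hR : MinimalLevelDescent.CanonicalReciprocityData) : _root_.Langlands :=
  MinimalLevelDescent.closes
    (Summit.Langlands.Langlands.Theorems.LevelPrimeDescent_of_resplit_proof hWM hLM hK (z_of_cells hRED hZB hZP)) hB hL hW hP hA hR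

end Summit.Langlands.Langlands.Theorems.LevelOneDyadic.Weight
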